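import Summits.QuantumAdvantage.QuantumAdvantage.Theorems.SosSandwichHomogeneousPBAAXorComposition

/-!
# Route `SosSandwich`, item `HomogeneousPBAA` (stmt-QuantumAdvantage-15241) — the iterated ADDRESS function:
# base and composition step (toolkit for the refutation `SosSandwichHomogeneousPBAARefutation`)

`A(y₁,y₂,y₃,y₄) = (y₁y₃ + y₁y₄ + y₂y₃ − y₂y₄)/2 = (y₁(y₃+y₄) + y₂(y₃−y₄))/2` is the `±1`-valued "address" function
of four `±1` bits (if `y₃ = y₄` it returns `y₁y₃`, else `y₂y₃`): a HOMOGENEOUS quadratic, balanced, every variable of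
influence `1/2`. This file proves, for the composition step `G' = A(G,G,G,G)` on four disjoint blocks
(`Fin ((n+n)+(n+n))`, blocks by `Fin.castAdd` / `Fin.natAdd` as in `SosSandwichHomogeneousPBAAXorComposition`) and
for the base `G₀ = 1 − 2x₀`, the five invariants of the iterated address function: total degree doubles
(`totalDegree_stepPoly`), `±1`-valuedness (`step_pm_one`), balancedness (`step_mean`), the Laplacian
eigen-equation with doubled eigenvalue `Σᵢ (G' − G'∘flipᵢ) = 2(2d) G'` (`step_laplacian`, Euler's identity for the
homogeneous quadratic `A`), and HALVING of every flip-sensitivity `E (G' − G'∘flipᵢ)² = I/2` (`step_influence`,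
since `E (∂_b A)² = 1/2` on balanced `±1` inputs); `base_props` is the case `k = 0`.
The step lemmas take the blockwise evaluation formula as a hypothesis (`hG'`), realised by the explicit polynomial
in `evalBool_stepPoly`. Elementary cube bookkeeping, no named facts.
[cite: ODonnell2014, §2.2–§2.3] [cite: EscuderoGutierrez2023, Thm. 1.6]
-/

set_option linter.dupNamespace false -- D-0017: single-problem summit ⇒ `QuantumAdvantage.QuantumAdvantage` by design

noncomputable section

namespace Summit.QuantumAdvantage.QuantumAdvantage.Theorems.SosSandwich

open Finset MvPolynomial Literature.Computability.QuantumComplexity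

namespace AddrWitness

variable {N N₁ N₂ : ℕ}

/-! ### Small evaluation / averaging helpers -/

/-- `evalBool` is multiplicative. [folklore] -/
theorem evalBool_mul' (p q : MvPolynomial (Fin N) ℝ) (x : Fin N → Bool) :
    evalBool (p * q) x = evalBool p x * evalBool q x := by
  unfold evalBool; exact map_mul _ _ _

/-- `evalBool` is additive. [folklore] -/
theorem evalBool_add' (p q : MvPolynomial (Fin N) ℝ) (x : Fin N → Bool) :
    evalBool (p + q) x = evalBool p x + evalBool q x := by
  unfold evalBool; exact map_add _ _ _

/-- `evalBool` respects subtraction. [folklore] -/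
theorem evalBool_sub' (p q : MvPolynomial (Fin N) ℝ) (x : Fin N → Bool) :
    evalBool (p - q) x = evalBool p x - evalBool q x := by
  unfold evalBool; exact map_sub _ _ _

/-- `evalBool` of a scalar multiple `C a * p`. [folklore] -/
theorem evalBool_C_mul' (a : ℝ) (p : MvPolynomial (Fin N) ℝ) (x : Fin N → Bool) :
    evalBool (C a * p) x = a * evalBool p x := by
  unfold evalBool; rw [map_mul, eval_C]

/-- `evalBool` of a constant. [folklore] -/
theorem evalBool_C' (a : ℝ) (x : Fin N → Bool) : evalBool (C a : MvPolynomial (Fin N) ℝ) x = a := by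
  unfold evalBool; exact eval_C _

/-- `evalBool 1 = 1`. [folklore] -/
theorem evalBool_one' (x : Fin N → Bool) : evalBool (1 : MvPolynomial (Fin N) ℝ) x = 1 := by
  unfold evalBool; exact map_one _

/-- A function of the first block has the same cube average. [folklore] -/
theorem boolAvg_comp_castAdd (f : (Fin N₁ → Bool) → ℝ) :
    boolAvg (fun z : Fin (N₁ + N₂) → Bool => f (z ∘ Fin.castAdd N₂)) = boolAvg f := by
  have h := boolAvg_blockMul (N₁ := N₁) (N₂ := N₂) f (fun _ => (1 : ℝ))
  simp only [mul_one, boolAvg_const] at h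
  exact h

/-- A function of the second block has the same cube average. [folklore] -/
theorem boolAvg_comp_natAdd (f : (Fin N₂ → Bool) → ℝ) :
    boolAvg (fun z : Fin (N₁ + N₂) → Bool => f (z ∘ Fin.natAdd N₁)) = boolAvg f := by
  have h := boolAvg_blockMul (N₁ := N₁) (N₂ := N₂) (fun _ => (1 : ℝ)) f
  simp only [one_mul, boolAvg_const] at h
  exact h

/-! ### The base: `G₀ = 1 − 2x₀` on one bit -/

/-- Values of `G₀ = 1 − 2x₀`. [folklore] -/
theorem evalBool_base (x : Fin 1 → Bool) :
    evalBool (1 - C 2 * X 0 : MvPolynomial (Fin 1) ℝ) x = if x 0 then -1 else 1 := by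
  rw [evalBool_sub', evalBool_C_mul', evalBool_one', evalBool_dictator]
  split_ifs <;> norm_num

/-- The base polynomial has the five properties at `k = 0`. [folklore] -/
theorem base_props :
    (1 - C 2 * X 0 : MvPolynomial (Fin 1) ℝ).totalDegree ≤ 2 ^ 0 ∧
    (∀ x, evalBool (1 - C 2 * X 0 : MvPolynomial (Fin 1) ℝ) x = 1 ∨
      evalBool (1 - C 2 * X 0 : MvPolynomial (Fin 1) ℝ) x = -1) ∧
    boolAvg (evalBool (1 - C 2 * X 0 : MvPolynomial (Fin 1) ℝ)) = 0 ∧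
    (∀ x, ∑ i, (evalBool (1 - C 2 * X 0 : MvPolynomial (Fin 1) ℝ) x -
        evalBool (1 - C 2 * X 0 : MvPolynomial (Fin 1) ℝ) (flipBit i x)) =
      2 * (2 : ℝ) ^ 0 * evalBool (1 - C 2 * X 0 : MvPolynomial (Fin 1) ℝ) x) ∧
    (∀ i, boolAvg (fun x => (evalBool (1 - C 2 * X 0 : MvPolynomial (Fin 1) ℝ) x -
        evalBool (1 - C 2 * X 0 : MvPolynomial (Fin 1) ℝ) (flipBit i x)) ^ 2) = 4 / (2 : ℝ) ^ 0) := by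
  refine ⟨?_, ?_, ?_, ?_, ?_⟩
  · refine (totalDegree_sub _ _).trans (max_le ?_ ((totalDegree_mul _ _).trans ?_))
    · simp [totalDegree_one]
    · simp [totalDegree_C, totalDegree_X]
  · intro x
    rw [evalBool_base]
    split_ifs <;> norm_num
  · unfold boolAvg
    rw [sum_cube_one]
    simp [evalBool_base]
  · intro x
    rw [Fin.sum_univ_one, evalBool_base, evalBool_base]
    simp only [flipBit, Function.update_self]
    cases x 0 <;> norm_num
  · intro i
    have hi : i = 0 := Subsingleton.elim _ _
    subst hi
    have hfun : (fun x : Fin 1 → Bool => (evalBool (1 - C 2 * X 0 : MvPolynomial (Fin 1) ℝ) x -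
        evalBool (1 - C 2 * X 0 : MvPolynomial (Fin 1) ℝ) (flipBit 0 x)) ^ 2) = fun _ => 4 := by
      funext x
      rw [evalBool_base, evalBool_base]
      simp only [flipBit, Function.update_self]
      cases x 0 <;> norm_num
    rw [hfun, boolAvg_const]
    norm_num

/-! ### The step: `G' = A(G, G, G, G)` on four disjoint blocks, `A(y) = (y₁(y₃ + y₄) + y₂(y₃ − y₄))/2` -/

section Step

variable {n : ℕ} {G : MvPolynomial (Fin n) ℝ}

/-- `g² = 1` pointwise for a `±1`-valued `g`. [folklore] -/
theorem sq_eq_one' (h2 : ∀ x, evalBool G x = 1 ∨ evalBool G x = -1) (x : Fin n → Bool) :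
    evalBool G x ^ 2 = 1 := by
  rcases h2 x with h | h <;> rw [h] <;> norm_num

/-- Average of `(g(v₁) + g(v₂))²` over a pair of blocks is `2` (cross term `2·E g·E g = 0`). [folklore] -/
theorem avg_sum_sq (h2 : ∀ x, evalBool G x = 1 ∨ evalBool G x = -1) (h3 : boolAvg (evalBool G) = 0) :
    boolAvg (fun v : Fin (n + n) → Bool =>
      (evalBool G (v ∘ Fin.castAdd n) + evalBool G (v ∘ Fin.natAdd n)) ^ 2) = 2 := by
  have hfun : (fun v : Fin (n + n) → Bool =>
      (evalBool G (v ∘ Fin.castAdd n) + evalBool G (v ∘ Fin.natAdd n)) ^ 2) =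
      fun v => 2 + 2 * (evalBool G (v ∘ Fin.castAdd n) * evalBool G (v ∘ Fin.natAdd n)) := by
    funext v
    linear_combination sq_eq_one' h2 (v ∘ Fin.castAdd n) + sq_eq_one' h2 (v ∘ Fin.natAdd n)
  rw [hfun, avg_add, boolAvg_const,
    avg_const_mul 2 (fun v : Fin (n + n) → Bool => evalBool G (v ∘ Fin.castAdd n) * evalBool G (v ∘ Fin.natAdd n)),
    boolAvg_blockMul (evalBool G) (evalBool G), h3]
  ring

/-- Average of `(g(v₁) − g(v₂))²` over a pair of blocks is `2`. [folklore] -/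
theorem avg_diff_sq (h2 : ∀ x, evalBool G x = 1 ∨ evalBool G x = -1) (h3 : boolAvg (evalBool G) = 0) :
    boolAvg (fun v : Fin (n + n) → Bool =>
      (evalBool G (v ∘ Fin.castAdd n) - evalBool G (v ∘ Fin.natAdd n)) ^ 2) = 2 := by
  have hfun : (fun v : Fin (n + n) → Bool =>
      (evalBool G (v ∘ Fin.castAdd n) - evalBool G (v ∘ Fin.natAdd n)) ^ 2) =
      fun v => 2 + (-2) * (evalBool G (v ∘ Fin.castAdd n) * evalBool G (v ∘ Fin.natAdd n)) := by
    funext v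
    linear_combination sq_eq_one' h2 (v ∘ Fin.castAdd n) + sq_eq_one' h2 (v ∘ Fin.natAdd n)
  rw [hfun, avg_add, boolAvg_const,
    avg_const_mul (-2) (fun v : Fin (n + n) → Bool => evalBool G (v ∘ Fin.castAdd n) * evalBool G (v ∘ Fin.natAdd n)),
    boolAvg_blockMul (evalBool G) (evalBool G), h3]
  ring

variable (G) in
/-- The explicit step polynomial `A(G,G,G,G)` evaluates blockwise:
`G'(w) = (g(u₁)(g(v₁)+g(v₂)) + g(u₂)(g(v₁)−g(v₂)))/2` on the four blocks `u₁, u₂, v₁, v₂` of `w`. [folklore] -/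
theorem evalBool_stepPoly (w : Fin ((n + n) + (n + n)) → Bool) :
    evalBool (C (1 / 2) *
      (rename (Fin.castAdd (n + n)) (rename (Fin.castAdd n) G) *
          rename (Fin.natAdd (n + n)) (rename (Fin.castAdd n) G + rename (Fin.natAdd n) G) +
        rename (Fin.castAdd (n + n)) (rename (Fin.natAdd n) G) *
          rename (Fin.natAdd (n + n)) (rename (Fin.castAdd n) G - rename (Fin.natAdd n) G))) w = 1 / 2 *
    (evalBool G ((w ∘ Fin.castAdd (n + n)) ∘ Fin.castAdd n) *
        (evalBool G ((w ∘ Fin.natAdd (n + n)) ∘ Fin.castAdd n) +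
          evalBool G ((w ∘ Fin.natAdd (n + n)) ∘ Fin.natAdd n)) +
      evalBool G ((w ∘ Fin.castAdd (n + n)) ∘ Fin.natAdd n) *
        (evalBool G ((w ∘ Fin.natAdd (n + n)) ∘ Fin.castAdd n) -
          evalBool G ((w ∘ Fin.natAdd (n + n)) ∘ Fin.natAdd n))) := by
  simp only [evalBool_add', evalBool_sub', evalBool_mul', evalBool_C', evalBool_rename_castAdd,
    evalBool_rename_natAdd]

/-- Total degree of the explicit step polynomial: at most twice that of `G`. [folklore] -/
theorem totalDegree_stepPoly {D : ℕ} (hG : G.totalDegree ≤ D) :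
    (C (1 / 2) *
      (rename (Fin.castAdd (n + n)) (rename (Fin.castAdd n) G) *
          rename (Fin.natAdd (n + n)) (rename (Fin.castAdd n) G + rename (Fin.natAdd n) G) +
        rename (Fin.castAdd (n + n)) (rename (Fin.natAdd n) G) *
          rename (Fin.natAdd (n + n)) (rename (Fin.castAdd n) G - rename (Fin.natAdd n) G)) :
      MvPolynomial (Fin ((n + n) + (n + n))) ℝ).totalDegree ≤ D + D := by
  have hr : ∀ {m m' : ℕ} (φ : Fin m → Fin m') (P : MvPolynomial (Fin m) ℝ) {E : ℕ},
      P.totalDegree ≤ E → (rename φ P).totalDegree ≤ E :=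
    fun φ P _ hP => (totalDegree_rename_le φ P).trans hP
  have h1 : (rename (Fin.castAdd n) G).totalDegree ≤ D := hr _ _ hG
  have h2 : (rename (Fin.natAdd n) G).totalDegree ≤ D := hr _ _ hG
  have hadd : (rename (Fin.castAdd n) G + rename (Fin.natAdd n) G).totalDegree ≤ D :=
    (totalDegree_add _ _).trans (max_le h1 h2)
  have hsub : (rename (Fin.castAdd n) G - rename (Fin.natAdd n) G).totalDegree ≤ D :=
    (totalDegree_sub _ _).trans (max_le h1 h2)
  refine (totalDegree_mul _ _).trans ?_
  rw [totalDegree_C, zero_add]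
  refine (totalDegree_add _ _).trans (max_le ?_ ?_)
  · exact (totalDegree_mul _ _).trans (Nat.add_le_add (hr _ _ h1) (hr _ _ hadd))
  · exact (totalDegree_mul _ _).trans (Nat.add_le_add (hr _ _ h2) (hr _ _ hsub))

section WithEval

variable {G' : MvPolynomial (Fin ((n + n) + (n + n))) ℝ}
  (hG' : ∀ w : Fin ((n + n) + (n + n)) → Bool, evalBool G' w = 1 / 2 *
    (evalBool G ((w ∘ Fin.castAdd (n + n)) ∘ Fin.castAdd n) *
        (evalBool G ((w ∘ Fin.natAdd (n + n)) ∘ Fin.castAdd n) +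
          evalBool G ((w ∘ Fin.natAdd (n + n)) ∘ Fin.natAdd n)) +
      evalBool G ((w ∘ Fin.castAdd (n + n)) ∘ Fin.natAdd n) *
        (evalBool G ((w ∘ Fin.natAdd (n + n)) ∘ Fin.castAdd n) -
          evalBool G ((w ∘ Fin.natAdd (n + n)) ∘ Fin.natAdd n))))
include hG'

/-- Flip of a variable of block `u₁`, seen on the four blocks. [folklore] -/
theorem step_flip_u₁ (w : Fin ((n + n) + (n + n)) → Bool) (i : Fin n) :
    evalBool G' w - evalBool G' (flipBit (Fin.castAdd (n + n) (Fin.castAdd n i)) w) =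
      (evalBool G ((w ∘ Fin.castAdd (n + n)) ∘ Fin.castAdd n) -
          evalBool G (flipBit i ((w ∘ Fin.castAdd (n + n)) ∘ Fin.castAdd n))) *
        (1 / 2 * (evalBool G ((w ∘ Fin.natAdd (n + n)) ∘ Fin.castAdd n) +
          evalBool G ((w ∘ Fin.natAdd (n + n)) ∘ Fin.natAdd n))) := by
  rw [hG' w, hG' (flipBit _ w), flipBit_castAdd_comp_castAdd, flipBit_castAdd_comp_natAdd,
    flipBit_castAdd_comp_castAdd, flipBit_castAdd_comp_natAdd]
  ring

/-- Flip of a variable of block `u₂`, seen on the four blocks. [folklore] -/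
theorem step_flip_u₂ (w : Fin ((n + n) + (n + n)) → Bool) (i : Fin n) :
    evalBool G' w - evalBool G' (flipBit (Fin.castAdd (n + n) (Fin.natAdd n i)) w) =
      (evalBool G ((w ∘ Fin.castAdd (n + n)) ∘ Fin.natAdd n) -
          evalBool G (flipBit i ((w ∘ Fin.castAdd (n + n)) ∘ Fin.natAdd n))) *
        (1 / 2 * (evalBool G ((w ∘ Fin.natAdd (n + n)) ∘ Fin.castAdd n) -
          evalBool G ((w ∘ Fin.natAdd (n + n)) ∘ Fin.natAdd n))) := by
  rw [hG' w, hG' (flipBit _ w), flipBit_castAdd_comp_castAdd, flipBit_castAdd_comp_natAdd,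
    flipBit_natAdd_comp_castAdd, flipBit_natAdd_comp_natAdd]
  ring

/-- Flip of a variable of block `v₁`, seen on the four blocks. [folklore] -/
theorem step_flip_v₁ (w : Fin ((n + n) + (n + n)) → Bool) (j : Fin n) :
    evalBool G' w - evalBool G' (flipBit (Fin.natAdd (n + n) (Fin.castAdd n j)) w) =
      (1 / 2 * (evalBool G ((w ∘ Fin.castAdd (n + n)) ∘ Fin.castAdd n) +
          evalBool G ((w ∘ Fin.castAdd (n + n)) ∘ Fin.natAdd n))) *
        (evalBool G ((w ∘ Fin.natAdd (n + n)) ∘ Fin.castAdd n) -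
          evalBool G (flipBit j ((w ∘ Fin.natAdd (n + n)) ∘ Fin.castAdd n))) := by
  rw [hG' w, hG' (flipBit _ w), flipBit_natAdd_comp_castAdd, flipBit_natAdd_comp_natAdd,
    flipBit_castAdd_comp_castAdd, flipBit_castAdd_comp_natAdd]
  ring

/-- Flip of a variable of block `v₂`, seen on the four blocks. [folklore] -/
theorem step_flip_v₂ (w : Fin ((n + n) + (n + n)) → Bool) (j : Fin n) :
    evalBool G' w - evalBool G' (flipBit (Fin.natAdd (n + n) (Fin.natAdd n j)) w) =
      (1 / 2 * (evalBool G ((w ∘ Fin.castAdd (n + n)) ∘ Fin.castAdd n) -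
          evalBool G ((w ∘ Fin.castAdd (n + n)) ∘ Fin.natAdd n))) *
        (evalBool G ((w ∘ Fin.natAdd (n + n)) ∘ Fin.natAdd n) -
          evalBool G (flipBit j ((w ∘ Fin.natAdd (n + n)) ∘ Fin.natAdd n))) := by
  rw [hG' w, hG' (flipBit _ w), flipBit_natAdd_comp_castAdd, flipBit_natAdd_comp_natAdd,
    flipBit_natAdd_comp_castAdd, flipBit_natAdd_comp_natAdd]
  ring

/-- Step: `±1`-valuedness is preserved (`A` is Boolean on Boolean inputs). [folklore] -/
theorem step_pm_one (h2 : ∀ x, evalBool G x = 1 ∨ evalBool G x = -1)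
    (w : Fin ((n + n) + (n + n)) → Bool) : evalBool G' w = 1 ∨ evalBool G' w = -1 := by
  rw [hG' w]
  rcases h2 ((w ∘ Fin.castAdd (n + n)) ∘ Fin.castAdd n) with a | a <;>
  rcases h2 ((w ∘ Fin.castAdd (n + n)) ∘ Fin.natAdd n) with b | b <;>
  rcases h2 ((w ∘ Fin.natAdd (n + n)) ∘ Fin.castAdd n) with c | c <;>
  rcases h2 ((w ∘ Fin.natAdd (n + n)) ∘ Fin.natAdd n) with e | e <;>
  (rw [a, b, c, e]; norm_num)

/-- Step: balancedness is preserved (each product of two block values averages to `0 · 0`). [folklore] -/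
theorem step_mean (h3 : boolAvg (evalBool G) = 0) : boolAvg (evalBool G') = 0 := by
  have hfun : evalBool G' = fun w : Fin ((n + n) + (n + n)) → Bool =>
      1 / 2 * evalBool G ((w ∘ Fin.castAdd (n + n)) ∘ Fin.castAdd n) *
          (evalBool G ((w ∘ Fin.natAdd (n + n)) ∘ Fin.castAdd n) +
            evalBool G ((w ∘ Fin.natAdd (n + n)) ∘ Fin.natAdd n)) +
        1 / 2 * evalBool G ((w ∘ Fin.castAdd (n + n)) ∘ Fin.natAdd n) *
          (evalBool G ((w ∘ Fin.natAdd (n + n)) ∘ Fin.castAdd n) -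
            evalBool G ((w ∘ Fin.natAdd (n + n)) ∘ Fin.natAdd n)) := by
    funext w; rw [hG' w]; ring
  rw [hfun, avg_add,
    boolAvg_blockMul (fun u : Fin (n + n) → Bool => 1 / 2 * evalBool G (u ∘ Fin.castAdd n))
      (fun v : Fin (n + n) → Bool => evalBool G (v ∘ Fin.castAdd n) + evalBool G (v ∘ Fin.natAdd n)),
    boolAvg_blockMul (fun u : Fin (n + n) → Bool => 1 / 2 * evalBool G (u ∘ Fin.natAdd n))
      (fun v : Fin (n + n) → Bool => evalBool G (v ∘ Fin.castAdd n) - evalBool G (v ∘ Fin.natAdd n)),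
    avg_const_mul (1 / 2) (fun u : Fin (n + n) → Bool => evalBool G (u ∘ Fin.castAdd n)),
    avg_const_mul (1 / 2) (fun u : Fin (n + n) → Bool => evalBool G (u ∘ Fin.natAdd n)),
    boolAvg_comp_castAdd (evalBool G), boolAvg_comp_natAdd (evalBool G), h3]
  ring

/-- Step: the Laplacian eigen-equation doubles its eigenvalue (`A` is a homogeneous QUADRATIC in the block
values: `Σ_b y_b ∂_b A = 2A`). [folklore] -/
theorem step_laplacian {d : ℝ}
    (h4 : ∀ x, ∑ i, (evalBool G x - evalBool G (flipBit i x)) = 2 * d * evalBool G x)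
    (w : Fin ((n + n) + (n + n)) → Bool) :
    ∑ i, (evalBool G' w - evalBool G' (flipBit i w)) = 2 * (2 * d) * evalBool G' w := by
  rw [Fin.sum_univ_add, Fin.sum_univ_add, Fin.sum_univ_add]
  simp_rw [step_flip_u₁ hG', step_flip_u₂ hG', step_flip_v₁ hG', step_flip_v₂ hG']
  rw [← Finset.sum_mul, ← Finset.sum_mul, ← Finset.mul_sum, ← Finset.mul_sum, h4, h4, h4, h4, hG' w]
  ring

/-- Step: every flip-sensitivity `E (G' − G'∘flipᵢ)²` is HALVED (the other pair of blocks contributes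
`E (∂_b A)² = 1/2`). [folklore] -/
theorem step_influence (h2 : ∀ x, evalBool G x = 1 ∨ evalBool G x = -1) (h3 : boolAvg (evalBool G) = 0)
    {I : ℝ} (h5 : ∀ i, boolAvg (fun x => (evalBool G x - evalBool G (flipBit i x)) ^ 2) = I)
    (i : Fin ((n + n) + (n + n))) :
    boolAvg (fun w => (evalBool G' w - evalBool G' (flipBit i w)) ^ 2) = I / 2 := by
  induction i using Fin.addCases with
  | left i =>
    induction i using Fin.addCases with
    | left i₀ =>
      have hfun : (fun w => (evalBool G' w - evalBool G' (flipBit (Fin.castAdd (n + n) (Fin.castAdd n i₀)) w)) ^ 2) =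
          fun w : Fin ((n + n) + (n + n)) → Bool =>
            1 / 4 * (evalBool G ((w ∘ Fin.castAdd (n + n)) ∘ Fin.castAdd n) -
                evalBool G (flipBit i₀ ((w ∘ Fin.castAdd (n + n)) ∘ Fin.castAdd n))) ^ 2 *
            (evalBool G ((w ∘ Fin.natAdd (n + n)) ∘ Fin.castAdd n) +
                evalBool G ((w ∘ Fin.natAdd (n + n)) ∘ Fin.natAdd n)) ^ 2 := by
        funext w; rw [step_flip_u₁ hG']; ring
      rw [hfun, boolAvg_blockMul (fun u : Fin (n + n) → Bool => 1 / 4 * (evalBool G (u ∘ Fin.castAdd n) -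
            evalBool G (flipBit i₀ (u ∘ Fin.castAdd n))) ^ 2)
          (fun v : Fin (n + n) → Bool => (evalBool G (v ∘ Fin.castAdd n) + evalBool G (v ∘ Fin.natAdd n)) ^ 2),
        avg_const_mul (1 / 4) (fun u : Fin (n + n) → Bool => (evalBool G (u ∘ Fin.castAdd n) -
            evalBool G (flipBit i₀ (u ∘ Fin.castAdd n))) ^ 2),
        avg_sum_sq h2 h3, boolAvg_comp_castAdd (fun x => (evalBool G x - evalBool G (flipBit i₀ x)) ^ 2), h5]
      ring
    | right i₀ =>
      have hfun : (fun w => (evalBool G' w - evalBool G' (flipBit (Fin.castAdd (n + n) (Fin.natAdd n i₀)) w)) ^ 2) =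
          fun w : Fin ((n + n) + (n + n)) → Bool =>
            1 / 4 * (evalBool G ((w ∘ Fin.castAdd (n + n)) ∘ Fin.natAdd n) -
                evalBool G (flipBit i₀ ((w ∘ Fin.castAdd (n + n)) ∘ Fin.natAdd n))) ^ 2 *
            (evalBool G ((w ∘ Fin.natAdd (n + n)) ∘ Fin.castAdd n) -
                evalBool G ((w ∘ Fin.natAdd (n + n)) ∘ Fin.natAdd n)) ^ 2 := by
        funext w; rw [step_flip_u₂ hG']; ring
      rw [hfun, boolAvg_blockMul (fun u : Fin (n + n) → Bool => 1 / 4 * (evalBool G (u ∘ Fin.natAdd n) -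
            evalBool G (flipBit i₀ (u ∘ Fin.natAdd n))) ^ 2)
          (fun v : Fin (n + n) → Bool => (evalBool G (v ∘ Fin.castAdd n) - evalBool G (v ∘ Fin.natAdd n)) ^ 2),
        avg_const_mul (1 / 4) (fun u : Fin (n + n) → Bool => (evalBool G (u ∘ Fin.natAdd n) -
            evalBool G (flipBit i₀ (u ∘ Fin.natAdd n))) ^ 2),
        avg_diff_sq h2 h3, boolAvg_comp_natAdd (fun x => (evalBool G x - evalBool G (flipBit i₀ x)) ^ 2), h5]
      ring
  | right j =>
    induction j using Fin.addCases with
    | left j₀ =>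
      have hfun : (fun w => (evalBool G' w - evalBool G' (flipBit (Fin.natAdd (n + n) (Fin.castAdd n j₀)) w)) ^ 2) =
          fun w : Fin ((n + n) + (n + n)) → Bool =>
            (evalBool G ((w ∘ Fin.castAdd (n + n)) ∘ Fin.castAdd n) +
                evalBool G ((w ∘ Fin.castAdd (n + n)) ∘ Fin.natAdd n)) ^ 2 *
            (1 / 4 * (evalBool G ((w ∘ Fin.natAdd (n + n)) ∘ Fin.castAdd n) -
                evalBool G (flipBit j₀ ((w ∘ Fin.natAdd (n + n)) ∘ Fin.castAdd n))) ^ 2) := by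
        funext w; rw [step_flip_v₁ hG']; ring
      rw [hfun, boolAvg_blockMul
          (fun u : Fin (n + n) → Bool => (evalBool G (u ∘ Fin.castAdd n) + evalBool G (u ∘ Fin.natAdd n)) ^ 2)
          (fun v : Fin (n + n) → Bool => 1 / 4 * (evalBool G (v ∘ Fin.castAdd n) -
            evalBool G (flipBit j₀ (v ∘ Fin.castAdd n))) ^ 2),
        avg_const_mul (1 / 4) (fun v : Fin (n + n) → Bool => (evalBool G (v ∘ Fin.castAdd n) -
            evalBool G (flipBit j₀ (v ∘ Fin.castAdd n))) ^ 2),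
        avg_sum_sq h2 h3, boolAvg_comp_castAdd (fun x => (evalBool G x - evalBool G (flipBit j₀ x)) ^ 2), h5]
      ring
    | right j₀ =>
      have hfun : (fun w => (evalBool G' w - evalBool G' (flipBit (Fin.natAdd (n + n) (Fin.natAdd n j₀)) w)) ^ 2) =
          fun w : Fin ((n + n) + (n + n)) → Bool =>
            (evalBool G ((w ∘ Fin.castAdd (n + n)) ∘ Fin.castAdd n) -
                evalBool G ((w ∘ Fin.castAdd (n + n)) ∘ Fin.natAdd n)) ^ 2 *
            (1 / 4 * (evalBool G ((w ∘ Fin.natAdd (n + n)) ∘ Fin.natAdd n) -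
                evalBool G (flipBit j₀ ((w ∘ Fin.natAdd (n + n)) ∘ Fin.natAdd n))) ^ 2) := by
        funext w; rw [step_flip_v₂ hG']; ring
      rw [hfun, boolAvg_blockMul
          (fun u : Fin (n + n) → Bool => (evalBool G (u ∘ Fin.castAdd n) - evalBool G (u ∘ Fin.natAdd n)) ^ 2)
          (fun v : Fin (n + n) → Bool => 1 / 4 * (evalBool G (v ∘ Fin.natAdd n) -
            evalBool G (flipBit j₀ (v ∘ Fin.natAdd n))) ^ 2),
        avg_const_mul (1 / 4) (fun v : Fin (n + n) → Bool => (evalBool G (v ∘ Fin.natAdd n) -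
            evalBool G (flipBit j₀ (v ∘ Fin.natAdd n))) ^ 2),
        avg_diff_sq h2 h3, boolAvg_comp_natAdd (fun x => (evalBool G x - evalBool G (flipBit j₀ x)) ^ 2), h5]
      ring

end WithEval

end Step

end AddrWitness

end Summit.QuantumAdvantage.QuantumAdvantage.Theorems.SosSandwich

end
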